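import Summits.QuantumAdvantage.QuantumAdvantage.Theorems.CharDialPrefixFaceA
import HarnessLib

/-!
# The prefix face of `WalkHardFJLinOdd`, part B: THE STAIRCASE CERTIFICATE (decomp-qadv lens-6 g16, tree part 29B)

Pure finite arithmetic, uniform in `p` (no `decide`): the 5-pattern sets on three blocks of free positions of sizes `(p,p,1)`,
`U = {100,010,001,011,111}` for `p ≡ 2 (mod 3)` (`patA`) and `U = {000,010,110,101,011}` for `p ≡ 1 (mod 3)` (`patB`);
their (prefix count, total weight) profiles `prof p j` at free time `j ≤ 2p+1`; the shifted class indicator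
`ind p s t w e (a, r) = [(a+s) % p = w ∧ (r+t) % 3 ≠ e % 3]`.
* `PrefixFace.balF_prof` — STAIRCASE BALANCE: for `p % 3 ≠ 0` and every `j ≤ 2p+1` and all shifts, `Σ_{i<5} ind … (prof p j i)`
  is EVEN — one cancelling pair (`ind_pair`) and one balanced triple (`ind_triple`) in each regime `j ≤ p ∣ p ≤ j ≤ 2p ∣ j = 2p+1`;
* `PrefixFace.certF` — the 25-point design `U × U` on six blocks `(p,p,1,p,p,1)` (`bit6`, `AA`) is balanced on every
  selected sub-family `{bit_{k₀} = v}` at every free time `j ≤ 4p+2` («balanced ⊗ anything is balanced», `sum_product`).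
Consumed by part 29 (`CharDialPrefixFace`).  Kernel-closed.
-/

set_option linter.dupNamespace false
set_option autoImplicit false

namespace Summit.QuantumAdvantage.AdviceFreeQNC0.JLinPeel

open Finset AffBells22

namespace PrefixFace

/-! ### SHIFTED CLASS INDICATORS, THE 5-PATTERN SETS, PAIR + TRIPLE BALANCE, THE 25-POINT CERTIFICATE -/

section Cert

/-- indicator of the shifted class «counter `≡ w (mod p)` and exponent `≢ e (mod 3)`». -/
def ind (p s t w e : ℕ) (q : ℕ × ℕ) : ℕ := if (q.1 + s) % p = w ∧ (q.2 + t) % 3 ≠ e % 3 then 1 else 0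

/-- `CharDialPrefixFace` helper (decomp-qadv land package, lens-6 g16; see the module docstring). -/
theorem ind_congr {p s₁ s₂ t₁ t₂ w e a₁ a₂ r₁ r₂ : ℕ} (h1 : a₁ + s₁ = a₂ + s₂) (h2 : r₁ + t₁ = r₂ + t₂) :
    ind p s₁ t₁ w e (a₁, r₁) = ind p s₂ t₂ w e (a₂, r₂) := by
  unfold ind; simp only [h1, h2]

/-- a CANCELLING PAIR: same counter class, same exponent class. -/
theorem ind_pair {p s t w e a₁ a₂ r₁ r₂ : ℕ} (ha : a₁ % p = a₂ % p) (hr : r₁ % 3 = r₂ % 3) :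
    ind p s t w e (a₁, r₁) = ind p s t w e (a₂, r₂) := by
  unfold ind
  have ha' : (a₁ + s) % p = (a₂ + s) % p := by rw [Nat.add_mod, ha, ← Nat.add_mod]
  have hr' : (r₁ + t) % 3 = (r₂ + t) % 3 := by omega
  simp only [ha', hr']

/-- a BALANCED TRIPLE: same counter class, the three exponents pairwise distinct mod 3. -/
theorem ind_triple {p s t w e a₁ a₂ a₃ r₁ r₂ r₃ : ℕ} (h12 : a₁ % p = a₂ % p) (h13 : a₁ % p = a₃ % p)
    (hr12 : r₁ % 3 ≠ r₂ % 3) (hr13 : r₁ % 3 ≠ r₃ % 3) (hr23 : r₂ % 3 ≠ r₃ % 3) :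
    Even (ind p s t w e (a₁, r₁) + ind p s t w e (a₂, r₂) + ind p s t w e (a₃, r₃)) := by
  unfold ind
  have h12' : (a₂ + s) % p = (a₁ + s) % p := by rw [Nat.add_mod, ← h12, ← Nat.add_mod]
  have h13' : (a₃ + s) % p = (a₁ + s) % p := by rw [Nat.add_mod, ← h13, ← Nat.add_mod]
  simp only [h12', h13']
  by_cases hA : (a₁ + s) % p = w
  · simp only [hA, true_and]
    split_ifs <;> first | decide | (exfalso; omega)
  · simp [hA]

/-- the 5-pattern sets on three blocks of free positions of sizes `(p, p, 1)`:
`A = {100, 010, 001, 011, 111}` (used when `p ≡ 2 mod 3`), `B = {000, 010, 110, 101, 011}` (when `p ≡ 1 mod 3`); `pat p i k` = bit of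
block `k` in pattern `i`. -/
def patA (i : Fin 5) (k : ℕ) : Bool :=
  decide ((i.val = 0 ∧ k = 0) ∨ (i.val = 1 ∧ k = 1) ∨ (i.val = 2 ∧ k = 2) ∨ (i.val = 3 ∧ (k = 1 ∨ k = 2)) ∨ (i.val = 4 ∧ k ≤ 2))
/-- `CharDialPrefixFace` helper (decomp-qadv land package, lens-6 g16; see the module docstring). -/
def patB (i : Fin 5) (k : ℕ) : Bool :=
  decide ((i.val = 1 ∧ k = 1) ∨ (i.val = 2 ∧ (k = 0 ∨ k = 1)) ∨ (i.val = 3 ∧ (k = 0 ∨ k = 2)) ∨ (i.val = 4 ∧ (k = 1 ∨ k = 2)))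
/-- `CharDialPrefixFace` helper (decomp-qadv land package, lens-6 g16; see the module docstring). -/
def pat (p : ℕ) (i : Fin 5) (k : ℕ) : Bool := if p % 3 = 2 then patA i k else patB i k

/-- free prefix count of pattern `i` after `j ≤ 2p+1` free positions (blocks `[0,p)`, `[p,2p)`, `{2p}` in free order). -/
def aA (p j : ℕ) (i : Fin 5) : ℕ :=
  (if pat p i 0 = true then min j p else 0) + (if pat p i 1 = true then min j (2 * p) - min j p else 0)
    + (if pat p i 2 = true then j - min j (2 * p) else 0)

/-- total free weight of pattern `i`. -/
def TT (p : ℕ) (i : Fin 5) : ℕ := (if pat p i 0 = true then p else 0) + (if pat p i 1 = true then p else 0) + (if pat p i 2 = true then 1 else 0)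

/-- the staircase profile at free-time `j`: (prefix count, total weight + prefix count) — the exponent of the walk label is
`W + W_{<g}`. -/
def prof (p j : ℕ) (i : Fin 5) : ℕ × ℕ := (aA p j i, TT p i + aA p j i)

section Values
variable {p j : ℕ}

/-- `CharDialPrefixFace` helper (decomp-qadv land package, lens-6 g16; see the module docstring). -/
theorem TT_A (hp : p % 3 = 2) : TT p 0 = p ∧ TT p 1 = p ∧ TT p 2 = 1 ∧ TT p 3 = p + 1 ∧ TT p 4 = 2 * p + 1 := by
  simp [TT, pat, patA, hp]; omega
/-- `CharDialPrefixFace` helper (decomp-qadv land package, lens-6 g16; see the module docstring). -/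
theorem TT_B (hp : p % 3 = 1) : TT p 0 = 0 ∧ TT p 1 = p ∧ TT p 2 = 2 * p ∧ TT p 3 = p + 1 ∧ TT p 4 = p + 1 := by
  have hp' : ¬ p % 3 = 2 := by omega
  simp [TT, pat, patB, hp']; omega
/-- `CharDialPrefixFace` helper (decomp-qadv land package, lens-6 g16; see the module docstring). -/
theorem aA_A1 (hp : p % 3 = 2) (hj : j ≤ p) : aA p j 0 = j ∧ aA p j 1 = 0 ∧ aA p j 2 = 0 ∧ aA p j 3 = 0 ∧ aA p j 4 = j := by
  simp [aA, pat, patA, hp]; omega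
/-- `CharDialPrefixFace` helper (decomp-qadv land package, lens-6 g16; see the module docstring). -/
theorem aA_A2 (hp : p % 3 = 2) (hj1 : p ≤ j) (hj2 : j ≤ 2 * p) :
    aA p j 0 = p ∧ aA p j 1 = j - p ∧ aA p j 2 = 0 ∧ aA p j 3 = j - p ∧ aA p j 4 = j := by
  simp [aA, pat, patA, hp]; omega
/-- `CharDialPrefixFace` helper (decomp-qadv land package, lens-6 g16; see the module docstring). -/
theorem aA_A3 (hp : p % 3 = 2) (hj : j = 2 * p + 1) :
    aA p j 0 = p ∧ aA p j 1 = p ∧ aA p j 2 = 1 ∧ aA p j 3 = p + 1 ∧ aA p j 4 = 2 * p + 1 := by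
  simp [aA, pat, patA, hp]; omega
/-- `CharDialPrefixFace` helper (decomp-qadv land package, lens-6 g16; see the module docstring). -/
theorem aA_B1 (hp : p % 3 = 1) (hj : j ≤ p) : aA p j 0 = 0 ∧ aA p j 1 = 0 ∧ aA p j 2 = j ∧ aA p j 3 = j ∧ aA p j 4 = 0 := by
  have hp' : ¬ p % 3 = 2 := by omega
  simp [aA, pat, patB, hp']; omega
/-- `CharDialPrefixFace` helper (decomp-qadv land package, lens-6 g16; see the module docstring). -/
theorem aA_B2 (hp : p % 3 = 1) (hj1 : p ≤ j) (hj2 : j ≤ 2 * p) :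
    aA p j 0 = 0 ∧ aA p j 1 = j - p ∧ aA p j 2 = j ∧ aA p j 3 = p ∧ aA p j 4 = j - p := by
  have hp' : ¬ p % 3 = 2 := by omega
  simp [aA, pat, patB, hp']; omega
/-- `CharDialPrefixFace` helper (decomp-qadv land package, lens-6 g16; see the module docstring). -/
theorem aA_B3 (hp : p % 3 = 1) (hj : j = 2 * p + 1) :
    aA p j 0 = 0 ∧ aA p j 1 = p ∧ aA p j 2 = 2 * p ∧ aA p j 3 = p + 1 ∧ aA p j 4 = p + 1 := by
  have hp' : ¬ p % 3 = 2 := by omega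
  simp [aA, pat, patB, hp']; omega

/-- at full free-time the prefix count is the total weight. -/
theorem aA_full (p : ℕ) (i : Fin 5) : aA p (2 * p + 1) i = TT p i := by
  unfold aA TT
  have h1 : min (2 * p + 1) p = p := min_eq_right (by omega)
  have h2 : min (2 * p + 1) (2 * p) = 2 * p := min_eq_right (by omega)
  rw [h1, h2]
  congr 1 <;> [congr 1; skip] <;> split_ifs <;> omega

end Values

/-- **STAIRCASE BALANCE of the 5-pattern set** (the heart of the certificate, uniform in `p`): for every `p ≢ 0 (mod 3)` and every free-time
`j ≤ 2p+1`, the profile is balanced — by one cancelling pair and one balanced triple in each of the three regimes `j ≤ p`, `p ≤ j ≤ 2p`,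
`j = 2p+1`. -/
theorem balF_prof {p j : ℕ} (hp : p % 3 ≠ 0) (hj : j ≤ 2 * p + 1) :
    ∀ s t w e : ℕ, Even (∑ i, ind p s t w e (prof p j i)) := by
  intro s t w e
  rw [Fin.sum_univ_five]
  simp only [prof]
  rcases (by omega : p % 3 = 2 ∨ p % 3 = 1) with hp3 | hp3
  · obtain ⟨T0, T1, T2, T3, T4⟩ := TT_A hp3
    rcases (by omega : j ≤ p ∨ (p ≤ j ∧ j ≤ 2 * p) ∨ j = 2 * p + 1) with hj' | ⟨hj1, hj2⟩ | hj'
    · obtain ⟨a0, a1, a2, a3, a4⟩ := aA_A1 hp3 hj'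
      rw [a0, a1, a2, a3, a4, T0, T1, T2, T3, T4]
      have hpair : ind p s t w e (j, p + j) = ind p s t w e (j, 2 * p + 1 + j) := ind_pair rfl (by omega)
      have htri := ind_triple (p := p) (s := s) (t := t) (w := w) (e := e) (a₁ := 0) (a₂ := 0) (a₃ := 0)
        (r₁ := p + 0) (r₂ := 1 + 0) (r₃ := p + 1 + 0) rfl rfl (by omega) (by omega) (by omega)
      rw [hpair]
      have : ind p s t w e (j, 2 * p + 1 + j) + ind p s t w e (0, p + 0) + ind p s t w e (0, 1 + 0) + ind p s t w e (0, p + 1 + 0)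
          + ind p s t w e (j, 2 * p + 1 + j) = 2 * ind p s t w e (j, 2 * p + 1 + j)
          + (ind p s t w e (0, p + 0) + ind p s t w e (0, 1 + 0) + ind p s t w e (0, p + 1 + 0)) := by ring
      rw [this]; exact (even_two_mul _).add htri
    · obtain ⟨a0, a1, a2, a3, a4⟩ := aA_A2 hp3 hj1 hj2
      rw [a0, a1, a2, a3, a4, T0, T1, T2, T3, T4]
      have hjp : (j - p) % p = j % p := by conv_rhs => rw [← Nat.sub_add_cancel hj1]; rw [Nat.add_mod_right]
      have hpair : ind p s t w e (p, p + p) = ind p s t w e (0, 1 + 0) := ind_pair (by simp) (by omega)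
      have htri := ind_triple (p := p) (s := s) (t := t) (w := w) (e := e) (a₁ := j - p) (a₂ := j - p) (a₃ := j)
        (r₁ := p + (j - p)) (r₂ := p + 1 + (j - p)) (r₃ := 2 * p + 1 + j) rfl hjp (by omega) (by omega) (by omega)
      rw [hpair]
      have : ind p s t w e (0, 1 + 0) + ind p s t w e (j - p, p + (j - p)) + ind p s t w e (0, 1 + 0)
          + ind p s t w e (j - p, p + 1 + (j - p)) + ind p s t w e (j, 2 * p + 1 + j)
          = 2 * ind p s t w e (0, 1 + 0)
          + (ind p s t w e (j - p, p + (j - p)) + ind p s t w e (j - p, p + 1 + (j - p)) + ind p s t w e (j, 2 * p + 1 + j)) := by ring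
      rw [this]; exact (even_two_mul _).add htri
    · obtain ⟨a0, a1, a2, a3, a4⟩ := aA_A3 hp3 hj'
      rw [a0, a1, a2, a3, a4, T0, T1, T2, T3, T4]
      have h1p : 1 % p = (p + 1) % p := (Nat.add_mod_left p 1).symm
      have h2p : 1 % p = (2 * p + 1) % p := by rw [mul_comm, Nat.mul_add_mod]
      have htri := ind_triple (p := p) (s := s) (t := t) (w := w) (e := e) (a₁ := 1) (a₂ := p + 1) (a₃ := 2 * p + 1)
        (r₁ := 1 + 1) (r₂ := p + 1 + (p + 1)) (r₃ := 2 * p + 1 + (2 * p + 1)) h1p h2p (by omega) (by omega) (by omega)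
      have : ind p s t w e (p, p + p) + ind p s t w e (p, p + p) + ind p s t w e (1, 1 + 1) + ind p s t w e (p + 1, p + 1 + (p + 1))
          + ind p s t w e (2 * p + 1, 2 * p + 1 + (2 * p + 1)) = 2 * ind p s t w e (p, p + p)
          + (ind p s t w e (1, 1 + 1) + ind p s t w e (p + 1, p + 1 + (p + 1)) + ind p s t w e (2 * p + 1, 2 * p + 1 + (2 * p + 1))) := by
        ring
      rw [this]; exact (even_two_mul _).add htri
  · obtain ⟨T0, T1, T2, T3, T4⟩ := TT_B hp3
    rcases (by omega : j ≤ p ∨ (p ≤ j ∧ j ≤ 2 * p) ∨ j = 2 * p + 1) with hj' | ⟨hj1, hj2⟩ | hj'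
    · obtain ⟨a0, a1, a2, a3, a4⟩ := aA_B1 hp3 hj'
      rw [a0, a1, a2, a3, a4, T0, T1, T2, T3, T4]
      have hpair : ind p s t w e (j, 2 * p + j) = ind p s t w e (j, p + 1 + j) := ind_pair rfl (by omega)
      have htri := ind_triple (p := p) (s := s) (t := t) (w := w) (e := e) (a₁ := 0) (a₂ := 0) (a₃ := 0)
        (r₁ := 0 + 0) (r₂ := p + 0) (r₃ := p + 1 + 0) rfl rfl (by omega) (by omega) (by omega)
      rw [hpair]
      have : ind p s t w e (0, 0 + 0) + ind p s t w e (0, p + 0) + ind p s t w e (j, p + 1 + j) + ind p s t w e (j, p + 1 + j)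
          + ind p s t w e (0, p + 1 + 0) = 2 * ind p s t w e (j, p + 1 + j)
          + (ind p s t w e (0, 0 + 0) + ind p s t w e (0, p + 0) + ind p s t w e (0, p + 1 + 0)) := by ring
      rw [this]; exact (even_two_mul _).add htri
    · obtain ⟨a0, a1, a2, a3, a4⟩ := aA_B2 hp3 hj1 hj2
      rw [a0, a1, a2, a3, a4, T0, T1, T2, T3, T4]
      have hjp : (j - p) % p = j % p := by conv_rhs => rw [← Nat.sub_add_cancel hj1]; rw [Nat.add_mod_right]
      have hpair : ind p s t w e (0, 0 + 0) = ind p s t w e (p, p + 1 + p) := ind_pair (by simp) (by omega)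
      have htri := ind_triple (p := p) (s := s) (t := t) (w := w) (e := e) (a₁ := j - p) (a₂ := j) (a₃ := j - p)
        (r₁ := p + (j - p)) (r₂ := 2 * p + j) (r₃ := p + 1 + (j - p)) hjp rfl (by omega) (by omega) (by omega)
      rw [hpair]
      have : ind p s t w e (p, p + 1 + p) + ind p s t w e (j - p, p + (j - p)) + ind p s t w e (j, 2 * p + j)
          + ind p s t w e (p, p + 1 + p) + ind p s t w e (j - p, p + 1 + (j - p))
          = 2 * ind p s t w e (p, p + 1 + p)
          + (ind p s t w e (j - p, p + (j - p)) + ind p s t w e (j, 2 * p + j) + ind p s t w e (j - p, p + 1 + (j - p))) := by ring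
      rw [this]; exact (even_two_mul _).add htri
    · obtain ⟨a0, a1, a2, a3, a4⟩ := aA_B3 hp3 hj'
      rw [a0, a1, a2, a3, a4, T0, T1, T2, T3, T4]
      have h0p : 0 % p = p % p := by simp
      have h0p' : 0 % p = (2 * p) % p := by simp
      have htri := ind_triple (p := p) (s := s) (t := t) (w := w) (e := e) (a₁ := 0) (a₂ := p) (a₃ := 2 * p)
        (r₁ := 0 + 0) (r₂ := p + p) (r₃ := 2 * p + 2 * p) h0p h0p' (by omega) (by omega) (by omega)
      have : ind p s t w e (0, 0 + 0) + ind p s t w e (p, p + p) + ind p s t w e (2 * p, 2 * p + 2 * p)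
          + ind p s t w e (p + 1, p + 1 + (p + 1)) + ind p s t w e (p + 1, p + 1 + (p + 1))
          = 2 * ind p s t w e (p + 1, p + 1 + (p + 1))
          + (ind p s t w e (0, 0 + 0) + ind p s t w e (p, p + p) + ind p s t w e (2 * p, 2 * p + 2 * p)) := by ring
      rw [this]; exact (even_two_mul _).add htri

/-- bit `k ∈ [0,6)` of the 6-block pattern `(i, i')` (blocks `0,1,2` from `i`, `3,4,5` from `i'`). -/
def bit6 (p : ℕ) (ik : Fin 5 × Fin 5) (k : ℕ) : Bool := if k < 3 then pat p ik.1 k else pat p ik.2 (k - 3)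

/-- free prefix count of the 6-block pattern after `j ≤ 4p+2` free positions. -/
def AA (p j : ℕ) (ik : Fin 5 × Fin 5) : ℕ := if j ≤ 2 * p + 1 then aA p j ik.1 else TT p ik.1 + aA p (j - (2 * p + 1)) ik.2

/-- **«balanced ⊕ anything is balanced»** — the certificate holds for every `p ≢ 0 (mod 3)`. -/
theorem certF {p : ℕ} (hp : p % 3 ≠ 0) :
    ∀ j ≤ 2 * (2 * p + 1), ∀ k₀ < 6, ∀ (v : Bool) (s t w e : ℕ),
      Even (∑ ik ∈ (univ : Finset (Fin 5 × Fin 5)).filter (fun ik => bit6 p ik k₀ = v),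
        ind p s t w e (AA p j ik, TT p ik.1 + TT p ik.2 + AA p j ik)) := by
  classical
  intro j hj k₀ hk₀ v s t w e
  by_cases hjm : j ≤ 2 * p + 1
  · simp only [AA, if_pos hjm]
    by_cases hk : k₀ < 3
    · -- selector on the first factor; the balanced factor is `i' ↦ (0, TT i')` = `prof p 0`
      have hset : (univ : Finset (Fin 5 × Fin 5)).filter (fun ik => bit6 p ik k₀ = v)
          = (univ.filter fun i : Fin 5 => pat p i k₀ = v) ×ˢ (univ : Finset (Fin 5)) := by
        ext ⟨i, i'⟩; simp [bit6, hk]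
      rw [hset, sum_product]
      refine even_sum _ fun i _ => ?_
      dsimp only
      have hb := balF_prof hp (by omega : 0 ≤ 2 * p + 1) (aA p j i + s) (TT p i + aA p j i + t) w e
      have h0 : ∀ i' : Fin 5, aA p 0 i' = 0 := fun i' => by simp [aA]
      have heq : (∑ i' : Fin 5, ind p s t w e (aA p j i, TT p i + TT p i' + aA p j i))
          = ∑ i' : Fin 5, ind p (aA p j i + s) (TT p i + aA p j i + t) w e (prof p 0 i') :=
        sum_congr rfl fun i' _ => by simp only [prof, h0]; exact ind_congr (by ring) (by ring)
      rw [heq]; exact hb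
    · have hset : (univ : Finset (Fin 5 × Fin 5)).filter (fun ik => bit6 p ik k₀ = v)
          = (univ : Finset (Fin 5)) ×ˢ (univ.filter fun i' : Fin 5 => pat p i' (k₀ - 3) = v) := by
        ext ⟨i, i'⟩; simp [bit6, hk]
      rw [hset, sum_product_right]
      refine even_sum _ fun i' _ => ?_
      dsimp only
      have hb := balF_prof hp hjm s (TT p i' + t) w e
      have heq : (∑ i : Fin 5, ind p s t w e (aA p j i, TT p i + TT p i' + aA p j i))
          = ∑ i : Fin 5, ind p s (TT p i' + t) w e (prof p j i) :=
        sum_congr rfl fun i _ => by simp only [prof]; exact ind_congr rfl (by ring)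
      rw [heq]; exact hb
  · simp only [AA, if_neg hjm]
    have hj' : j - (2 * p + 1) ≤ 2 * p + 1 := by omega
    by_cases hk : k₀ < 3
    · -- selector on the first factor; balanced factor = `prof p (j - m)` on the second
      have hset : (univ : Finset (Fin 5 × Fin 5)).filter (fun ik => bit6 p ik k₀ = v)
          = (univ.filter fun i : Fin 5 => pat p i k₀ = v) ×ˢ (univ : Finset (Fin 5)) := by
        ext ⟨i, i'⟩; simp [bit6, hk]
      rw [hset, sum_product]
      refine even_sum _ fun i _ => ?_
      dsimp only
      have hb := balF_prof hp hj' (TT p i + s) (TT p i + TT p i + t) w e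
      have heq : (∑ i' : Fin 5, ind p s t w e (TT p i + aA p (j - (2 * p + 1)) i',
            TT p i + TT p i' + (TT p i + aA p (j - (2 * p + 1)) i')))
          = ∑ i' : Fin 5, ind p (TT p i + s) (TT p i + TT p i + t) w e (prof p (j - (2 * p + 1)) i') :=
        sum_congr rfl fun i' _ => by simp only [prof]; exact ind_congr (by ring) (by ring)
      rw [heq]; exact hb
    · -- selector on the second factor; balanced factor = `prof p m` (`aA p m = TT`) on the first
      have hset : (univ : Finset (Fin 5 × Fin 5)).filter (fun ik => bit6 p ik k₀ = v)
          = (univ : Finset (Fin 5)) ×ˢ (univ.filter fun i' : Fin 5 => pat p i' (k₀ - 3) = v) := by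
        ext ⟨i, i'⟩; simp [bit6, hk]
      rw [hset, sum_product_right]
      refine even_sum _ fun i' _ => ?_
      dsimp only
      have hb := balF_prof hp le_rfl (aA p (j - (2 * p + 1)) i' + s) (TT p i' + aA p (j - (2 * p + 1)) i' + t) w e
      have heq : (∑ i : Fin 5, ind p s t w e (TT p i + aA p (j - (2 * p + 1)) i',
            TT p i + TT p i' + (TT p i + aA p (j - (2 * p + 1)) i')))
          = ∑ i : Fin 5, ind p (aA p (j - (2 * p + 1)) i' + s) (TT p i' + aA p (j - (2 * p + 1)) i' + t) w e
              (prof p (2 * p + 1) i) :=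
        sum_congr rfl fun i _ => by simp only [prof, aA_full]; exact ind_congr (by ring) (by ring)
      rw [heq]; exact hb

end Cert

end PrefixFace

end Summit.QuantumAdvantage.AdviceFreeQNC0.JLinPeel
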